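import Summits.BirchSwinnertonDyer.Rank1Residual.GaloisImage.MultiplicativeLargeImage
import Summits.BirchSwinnertonDyer.Rank1Residual.AdditivePotMult.Twist
import Summits.BirchSwinnertonDyer.Rank1Residual.Additive.QuadraticTwistSurj
import HarnessLib

/-!
# BSD rank-≤1 residual cell: `ρ̄_{E,p}` is SURJECTIVE at every POTENTIALLY MULTIPLICATIVE additive
# prime `p ≥ 11` with `E[p]` irreducible (class X4(M)) — by a quadratic twist to the multiplicative case

HONEST FRAMING (cell `b2b-bsdres-*`, run/shared/lean/b2b/bsd-rank1-residual/, verbatim): the goal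
of the cell is to DELETE the COMBINATION-SHAPED residual classes for ALL analytic-rank `≤ 1` elliptic
curves over `ℚ` — "full BSD formula for every rank `≤ 1` curve in class C" assembled STRICTLY from
published theorems — so that the rank-`≤ 1` remainder becomes exactly the CONSTRUCTION-SHAPED
classes, which are TYPED (missing-input Props), NOT attempted; this is not "finishing BSD".
Prove what is provable now; shrink each hard class to its core with data; no claim beyond stated
classes. Unit `b2b-bsdres-x11c` (gen 7), for the sub-cell `additive-p1` (CLASS-OWNERS row X3/X4
additive — potentially multiplicative). Theorems only; no definition, no new named fact; NO label
change (X4, X4(M) stay CONSTRUCTION-SHAPED); what moves is one HYPOTHESIS: the `Surj W p` binder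
of the X4(M) theorems (`AdditivePotMult/RankOneHeegnerClass.lean`: "surjectivity is a genuine
hypothesis — Serre's `surj_of_irr_of_ram` needs semistability") is a THEOREM at `p ≥ 11`.

## What this file proves

* **`PotMult.surj_of_irr_of_eleven_le`** — for `E = W/ℚ` elliptic, `p ≥ 11` a prime of additive,
  POTENTIALLY MULTIPLICATIVE reduction (`PotMult W p`: `Addv ∧ ord_p j < 0`) with `E[p]`
  irreducible: `ρ̄_{E,p}` is onto — given the ONE published named fact
  `BalakrishnanEtAl2019.thm12_not_le_normalizer_splitCartan` (BDMTV 2019 Thm. 1.2 / Bilu–Parent–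
  Rebolledo 2013 Cor. 1.2).  Proof: a quadratic twist `E^{(d)}` is MULTIPLICATIVE at `p`
  (`PotMult.exists_twist_mult`, Silverman *ATAEC* V.5.3); `E^{(d)}[p] ≅ E[p] ⊗ χ_d` is irreducible
  (`irr_iff_of_model_twist`); so `ρ̄_{E^{(d)},p}` is onto by the multiplicative theorem
  `GaloisImage.surj_of_mult_of_irr_of_eleven_le` (Serre 1972 §1.12 + Props. 14/15/17 + the fact);
  and surjectivity is a twist invariant (`Additive.surj_iff_of_model_twist`).
* `PotMult.eq_five_or_eq_seven_of_irr_of_not_surj` — at a potentially multiplicative `p ≥ 5`,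
  `Irr ∧ ¬Surj` forces `p ∈ {5, 7}`.
* `ClassX4M.surj_of_eleven_le`, `ClassX4M.eq_five_or_eq_seven_of_not_surj` — class forms
  (`ClassX4M = ClassX4 ∧ PotMult`, `ClassX4 = p ≠ 2 ∧ Addv ∧ Irr`).

So the three "irreducible but not surjective at `p ≥ 5`" families of the census — X9 (good
ordinary, `X9ImageShape`), X11 ∧ ¬ram (multiplicative, `MultiplicativeLargeImage`), X4(M)
(potentially multiplicative, here) — are all supported at `p ∈ {5, 7}` only; the remaining
reduction types at `p` (good supersingular, additive potentially good) carry a different inertia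
shape and are not touched.

## References

* [SerreInventiones1972] J.-P. Serre, Invent. Math. 15 (1972), §1.12, §2.2, §2.7.
* [BalakrishnanEtAl2019] Balakrishnan–Dogra–Müller–Tuitman–Vonk, Ann. of Math. 189 (2019), Thm. 1.2.
* [BiluParentRebolledo2013] Bilu–Parent–Rebolledo, Ann. Inst. Fourier 63 (2013), Cor. 1.2.
* [SilvermanATAEC1994] J. H. Silverman, *Advanced Topics*, V.5.3 (potentially multiplicative =
  twist of a Tate curve).
-/

noncomputable section

open scoped Classical
open WeierstrassCurve Literature.NumberTheory.EllipticCurves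
  Literature.NumberTheory.EllipticCurves.Rank1Residual
  Literature.NumberTheory.EllipticCurves.BalakrishnanEtAl2019

namespace Summit.BirchSwinnertonDyer.Rank1Residual.AdditivePotMult

open GaloisImage Additive

variable {W : WeierstrassCurve ℚ} [W.IsElliptic] {p : ℕ} [hp : Fact p.Prime]

/-- **Potentially multiplicative `p ≥ 11`, `E[p]` irreducible ⟹ `ρ̄_{E,p}` onto** (twist to the
multiplicative case, `GaloisImage.surj_of_mult_of_irr_of_eleven_le`, twist invariance of `Irr` and
`Surj`). [cite: BalakrishnanEtAl2019, §1 Thm. 1.2 (arXiv:1711.05846 p. 2)]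
[cite: SerreInventiones1972, §1.12, §2.7 Prop. 17] [cite: SilvermanATAEC1994, V.5.3] -/
theorem PotMult.surj_of_irr_of_eleven_le (hB : thm12_not_le_normalizer_splitCartan)
    (hpm : PotMult W p) (hirr : Irr W p) (h11 : 11 ≤ p) : Surj W p := by
  obtain ⟨d, hd0, hmultd⟩ := hpm.exists_twist_mult
  haveI := W.isElliptic_quadraticTwist hd0
  have hWd : ∃ C : VariableChange ℚ, C • W.quadraticTwist d = W.quadraticTwist d := ⟨1, one_smul _ _⟩
  have hirr' : Irr (W.quadraticTwist d) p := (irr_iff_of_model_twist (W := W) hd0 hWd).mpr hirr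
  have hs' : Surj (W.quadraticTwist d) p :=
    surj_of_mult_of_irr_of_eleven_le (W.quadraticTwist d) p hB h11 hmultd hirr'
  exact (surj_iff_of_model_twist W p hd0 hWd).mp hs'

/-- **At a potentially multiplicative `p ≥ 5`, `Irr ∧ ¬Surj` forces `p = 5 ∨ p = 7`.**
[cite: BalakrishnanEtAl2019, §1 Thm. 1.2 (arXiv:1711.05846 p. 2)] -/
theorem PotMult.eq_five_or_eq_seven_of_irr_of_not_surj (hB : thm12_not_le_normalizer_splitCartan)
    (h5 : 5 ≤ p) (hpm : PotMult W p) (hirr : Irr W p) (hns : ¬ Surj W p) : p = 5 ∨ p = 7 := by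
  obtain ⟨d, hd0, hmultd⟩ := hpm.exists_twist_mult
  haveI := W.isElliptic_quadraticTwist hd0
  have hWd : ∃ C : VariableChange ℚ, C • W.quadraticTwist d = W.quadraticTwist d := ⟨1, one_smul _ _⟩
  have hirr' : Irr (W.quadraticTwist d) p := (irr_iff_of_model_twist (W := W) hd0 hWd).mpr hirr
  have hns' : ¬ Surj (W.quadraticTwist d) p := fun h ↦ hns ((surj_iff_of_model_twist W p hd0 hWd).mp h)
  exact eq_five_or_eq_seven_of_mult_of_irr_of_not_surj (W.quadraticTwist d) p hB h5 hmultd hirr' hns'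

/-- **Class X4(M) at `p ≥ 11`: `ρ̄_{E,p}` is onto** (`ClassX4M = (p ≠ 2 ∧ Addv ∧ Irr) ∧ PotMult`).
Discharges the `Surj W p` binder of the sub-cell's X4(M) theorems at `p ≥ 11`; label unchanged.
[cite: BalakrishnanEtAl2019, §1 Thm. 1.2 (arXiv:1711.05846 p. 2)] -/
theorem ClassX4M.surj_of_eleven_le (hB : thm12_not_le_normalizer_splitCartan) (hX : ClassX4M W p)
    (h11 : 11 ≤ p) : Surj W p :=
  PotMult.surj_of_irr_of_eleven_le hB (ClassX4M.potMult W p hX) (ClassX4M.irr W p hX) h11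

/-- **Class X4(M) with `ρ̄_{E,p}` NOT onto lives at `p ∈ {5, 7}`** (`p ≥ 5`).
[cite: BalakrishnanEtAl2019, §1 Thm. 1.2 (arXiv:1711.05846 p. 2)] -/
theorem ClassX4M.eq_five_or_eq_seven_of_not_surj (hB : thm12_not_le_normalizer_splitCartan)
    (hX : ClassX4M W p) (h5 : 5 ≤ p) (hns : ¬ Surj W p) : p = 5 ∨ p = 7 :=
  PotMult.eq_five_or_eq_seven_of_irr_of_not_surj hB h5 (ClassX4M.potMult W p hX)
    (ClassX4M.irr W p hX) hns

end Summit.BirchSwinnertonDyer.Rank1Residual.AdditivePotMult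

end
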